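import Summits.KontsevichZagierPeriods.Zeta5Search.Zudilin2003Rates
import Literature.NumberTheory.Irrationality.Zudilin2003.CatalanRemarksTheorem1
import Summits.KontsevichZagierPeriods.Zeta5Search.Certificates.RowCertificate
import HarnessLib

/-!
# ζ(5) search — the Catalan row (Zudilin 2003) as a `RowCertificate catalanConstant` — a NEAR-MISS with PROVED denominators (cell `pub-zeta5`, certifier `cert-1`)

HONEST FRAMING: systematic search; no irrationality claim unless certified. An exponent `γ < 1` never bears on
irrationality; `G` is not known to be irrational.

Row G of `NEAR-MISSES.md` in the format of `Certificates/RowCertificate.lean`, EVERY field a tree theorem and NO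
denominator model: `u, v` = Zudilin's 2003 second-order sequence (`Literature…Zudilin2003.u/v`), growth
`b = log((1+√5)/2)⁵` (`Zudilin2003Growth.tendsto_log_u_div`), decay `c = log((1+√5)/2)⁵`
(`Zudilin2003Growth.tendsto_log_abs_form_div`, unconditional since the lit seat's `tendsto_v_div_u`), effective
denominators `Dₙ = 2^{4n+e(n)}·lcm(1..2n−1)²` with `e(n) = o(n)` and `Dₙuₙ, Dₙvₙ ∈ ℤ` for ALL `n`
(`Zudilin2003.remarksTheorem1_holds` = Zudilin, *A few remarks on linear forms involving Catalan's constant*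
(2002), Theorem 1, PROVED in the tree), `δ = 4 log 2 + 4` (`remarksTheorem1.tendsto_log_denom`).

Outcome: `catalanRow : RowCertificate catalanConstant` (ARITHMETIC tier, unconditional) with
`margin = log((1+√5)/2)⁵ − 4 log 2 − 4 ∈ (−4.3666, −4.3665)` (exact `−4.36652…`: a near-miss) and
**`worthiness ∈ (0.5242, 0.5243)`** (exact `γ = 0.524273…` = the printed record exponent for `G`, Nesterenko 2016;
cf. `CatalanRecord.record_unconditional`, the same fact in `|G − P/Q| < Q^{−0.5242}` form). Certified brackets:
`log((1+√5)/2)⁵ = log((11+5√5)/2) ∈ (2.40605, 2.40607)`, `log 2` from Mathlib's `Real.log_two_gt_d9/lt_d9`.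
This is the third calibration row and the first `RowCertificate` of the cell with a NEGATIVE margin and proved
denominators — the shape every near-miss row takes once its arithmetic is a theorem.
-/

noncomputable section

open Filter Topology
open Literature.NumberTheory.Irrationality.Zudilin2003
open Literature.NumberTheory.Transcendental (catalanConstant)
open Summit.KontsevichZagierPeriods.Zeta5Search.Zudilin2003Growth (uR uR_pos tendsto_log_u_div)

namespace Summit.KontsevichZagierPeriods.Zeta5Search.Certificates

namespace CatalanRow

/-! ### Certified brackets for `log((1+√5)/2)⁵` -/

/-- `2.40605 < log 11.0901675` (certified: `e^L = (e^(L/4))^4 ≤ (Taylor₁₄ + err)^4 < 11.0901675000`). -/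
theorem log_phi5_lo : (240605 / 100000 : ℝ) < Real.log (110901675 / 10000000 : ℝ) := by
  have hx : |(48121 / 80000 : ℝ)| ≤ 1 := by rw [abs_le]; constructor <;> norm_num
  have hb := (abs_sub_le_iff.1 (Real.exp_bound hx (n := 14) (by norm_num))).1
  norm_num [Finset.sum_range_succ, Finset.sum_range_zero, Nat.factorial] at hb
  rw [Real.lt_log_iff_exp_lt (by norm_num), show (240605 / 100000 : ℝ) = ((4:ℕ):ℝ) * (48121 / 80000 : ℝ) by norm_num,
    Real.exp_nat_mul]
  exact lt_of_le_of_lt (pow_le_pow_left₀ (Real.exp_pos _).le hb 4) (by norm_num)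

/-- `log 11.090170 < 2.40607` (certified: `e^U = (e^(U/4))^4 ≥ (Taylor₁₄ − err)^4 > 11.0901700000`). -/
theorem log_phi5_hi : Real.log (11090170 / 1000000 : ℝ) < (240607 / 100000 : ℝ) := by
  have hx : |(240607 / 400000 : ℝ)| ≤ 1 := by rw [abs_le]; constructor <;> norm_num
  have hb := (abs_sub_le_iff.1 (Real.exp_bound hx (n := 14) (by norm_num))).2
  norm_num [Finset.sum_range_succ, Finset.sum_range_zero, Nat.factorial] at hb
  have h1 := sub_le_iff_le_add'.mpr hb
  rw [Real.log_lt_iff_lt_exp (by norm_num), show (240607 / 100000 : ℝ) = ((4:ℕ):ℝ) * (240607 / 400000 : ℝ) by norm_num,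
    Real.exp_nat_mul]
  exact lt_of_lt_of_le (by norm_num) (pow_le_pow_left₀ (by norm_num) h1 4)

/-- `((1+√5)/2)⁵ = (11 + 5√5)/2`. -/
theorem golden_fifth_eq : (((1 + Real.sqrt 5) / 2) ^ 5 : ℝ) = (11 + 5 * Real.sqrt 5) / 2 := by
  have hs : Real.sqrt 5 ^ 2 = 5 := Real.sq_sqrt (by norm_num)
  linear_combination ((Real.sqrt 5) ^ 3 + 5 * (Real.sqrt 5) ^ 2 + 15 * Real.sqrt 5 + 35) / 32 * hs

/-- `11.0901675 < ((1+√5)/2)⁵ < 11.090170` (from `2.2360679 < √5 < 2.236068`). -/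
theorem golden_fifth_mem :
    (110901675 / 10000000 : ℝ) < ((1 + Real.sqrt 5) / 2) ^ 5 ∧ ((1 + Real.sqrt 5) / 2) ^ 5 < (11090170 / 1000000 : ℝ) := by
  rw [golden_fifth_eq]
  have h1 : (22360679 / 10 ^ 7 : ℝ) < Real.sqrt 5 := by
    rw [Real.lt_sqrt (by norm_num)]; norm_num
  have h2 : Real.sqrt 5 < (2236068 / 10 ^ 6 : ℝ) := by
    rw [Real.sqrt_lt' (by norm_num)]; norm_num
  constructor <;> linarith

/-- **`2.40605 < log((1+√5)/2)⁵ < 2.40607`** (`= 5 log φ = 2.4060591…`). -/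
theorem log_golden_fifth_mem :
    (240605 / 100000 : ℝ) < Real.log (((1 + Real.sqrt 5) / 2) ^ 5) ∧
      Real.log (((1 + Real.sqrt 5) / 2) ^ 5) < (240607 / 100000 : ℝ) := by
  obtain ⟨h1, h2⟩ := golden_fifth_mem
  have hpos : (0 : ℝ) < 110901675 / 10000000 := by norm_num
  constructor
  · exact log_phi5_lo.trans (Real.log_lt_log hpos h1)
  · exact (Real.log_lt_log (hpos.trans h1) h2).trans log_phi5_hi

/-! ### The proved denominators `2^{4n+e(n)} lcm(1..2n−1)²` -/

/-- The exponent correction `e(n) = o(n)` of Zudilin's Theorem 1 (remarks paper), chosen from the PROVED fact. -/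
def eSeq : ℕ → ℕ := (remarksTheorem1.tendsto_log_denom remarksTheorem1_holds).choose

/-- Specification of `eSeq`: integrality of `2^{4n+e(n)}uₙ` and `2^{4n+e(n)}lcm(1..2n−1)²vₙ` for all `n`, and the
rate `log(2^{4n+e(n)}lcm(1..2n−1)²)/n → 4 log 2 + 4`. -/
theorem eSeq_spec :
    (∀ n : ℕ, (∃ z : ℤ, (z : ℚ) = 2 ^ (4 * n + eSeq n) * u n)
        ∧ (∃ z : ℤ, (z : ℚ) = 2 ^ (4 * n + eSeq n) * (Nat.lcmUpto (2 * n - 1) : ℚ) ^ 2 * v n))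
      ∧ Tendsto (fun n : ℕ => Real.log ((2 : ℝ) ^ (4 * n + eSeq n) * (Nat.lcmUpto (2 * n - 1) : ℝ) ^ 2) / n)
          atTop (𝓝 (4 * Real.log 2 + 4)) :=
  (remarksTheorem1.tendsto_log_denom remarksTheorem1_holds).choose_spec

/-! ### The row -/

/-- **The Catalan row**: `u, v` = Zudilin 2003, `b = c = log((1+√5)/2)⁵`, `Dₙ = 2^{4n+e(n)}lcm(1..2n−1)²`,
`δ = 4 log 2 + 4` — all fields tree theorems (no model, no cited hypothesis). -/
def catalanRow : RowCertificate catalanConstant where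
  u := u
  v := v
  growthRate := Real.log (((1 + Real.sqrt 5) / 2) ^ 5)
  decayRate := Real.log (((1 + Real.sqrt 5) / 2) ^ 5)
  tendsto_growth := by
    refine tendsto_log_u_div.congr' (Eventually.of_forall fun n => ?_)
    have h : (0 : ℝ) < (u n : ℝ) := uR_pos n
    simp only [abs_of_pos h]
  tendsto_decay := by
    have h := Zudilin2003Growth.tendsto_log_abs_form_div
    unfold form at h
    exact h
  decayRate_pos := by linarith [log_golden_fifth_mem.1]
  denom n := 2 ^ (4 * n + eSeq n) * Nat.lcmUpto (2 * n - 1) ^ 2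
  denom_pos n := Nat.mul_pos (Nat.pow_pos (by norm_num)) (Nat.pow_pos (Nat.lcmUpto_pos _))
  denomRate := 4 * Real.log 2 + 4
  tendsto_denom := by
    refine eSeq_spec.2.congr' (Eventually.of_forall fun n => ?_)
    push_cast
    rfl
  isInt_u := Eventually.of_forall fun n => by
    obtain ⟨z, hz⟩ := (eSeq_spec.1 n).1
    refine ⟨(Nat.lcmUpto (2 * n - 1) : ℤ) ^ 2 * z, ?_⟩
    push_cast
    rw [hz]; ring
  isInt_v := Eventually.of_forall fun n => by
    obtain ⟨z, hz⟩ := (eSeq_spec.1 n).2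
    refine ⟨z, ?_⟩
    push_cast
    rw [hz]

/-- The margin of the Catalan row: `μ₁ = log((1+√5)/2)⁵ − (4 log 2 + 4)`. -/
theorem catalanRow_margin :
    catalanRow.margin = Real.log (((1 + Real.sqrt 5) / 2) ^ 5) - (4 * Real.log 2 + 4) := rfl

/-- **`−4.3666 < μ₁ < −4.3665`** (exact `−4.36652…`): the row is a NEAR-MISS (needs `e^{4.37}` more decay per step). -/
theorem catalanRow_margin_mem :
    (-(43666 / 10000) : ℝ) < catalanRow.margin ∧ catalanRow.margin < (-(43665 / 10000) : ℝ) := by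
  rw [catalanRow_margin]
  obtain ⟨h1, h2⟩ := log_golden_fifth_mem
  have h3 := Real.log_two_gt_d9
  have h4 := Real.log_two_lt_d9
  constructor <;> linarith

/-- The margin is negative: no certificate from this row. -/
theorem catalanRow_margin_neg : catalanRow.margin < 0 := by linarith [catalanRow_margin_mem.2]

/-- The coefficient rate: `Q = log((1+√5)/2)⁵ + 4 log 2 + 4` (`= 9.17864…`, the type of `Qₙ = Dₙuₙ`). -/
theorem catalanRow_coeffRate :
    catalanRow.coeffRate = Real.log (((1 + Real.sqrt 5) / 2) ^ 5) + (4 * Real.log 2 + 4) := rfl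

/-- The worthiness of the Catalan row: `γ = 1 + μ₁/Q`. -/
theorem catalanRow_worthiness :
    catalanRow.worthiness = 1 + (Real.log (((1 + Real.sqrt 5) / 2) ^ 5) - (4 * Real.log 2 + 4)) /
      (Real.log (((1 + Real.sqrt 5) / 2) ^ 5) + (4 * Real.log 2 + 4)) := rfl

/-- **`0.5242 < γ < 0.5243`** (exact `γ = 0.524273…`, the printed record exponent for Catalan's constant;
eventually `|G − vₙ/uₙ| = (Dₙuₙ)^{−γ+o(1)}`). -/
theorem catalanRow_worthiness_mem :
    (5242 / 10000 : ℝ) < catalanRow.worthiness ∧ catalanRow.worthiness < (5243 / 10000 : ℝ) := by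
  rw [catalanRow_worthiness]
  obtain ⟨h1, h2⟩ := log_golden_fifth_mem
  have h3 := Real.log_two_gt_d9
  have h4 := Real.log_two_lt_d9
  set L := Real.log (((1 + Real.sqrt 5) / 2) ^ 5) with hL
  set T := Real.log 2 with hT
  have hQ : 0 < L + (4 * T + 4) := by linarith
  constructor
  · have : (-(4758 / 10000) : ℝ) * (L + (4 * T + 4)) < L - (4 * T + 4) := by nlinarith
    have := (lt_div_iff₀ hQ).2 this
    linarith
  · have : L - (4 * T + 4) < (-(4757 / 10000) : ℝ) * (L + (4 * T + 4)) := by nlinarith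
    have := (div_lt_iff₀ hQ).2 this
    linarith

/-- The forms `uₙG − vₙ` of the row tend to zero (from the rate alone). -/
theorem catalanRow_tendsto_form : Tendsto catalanRow.form atTop (𝓝 0) :=
  catalanRow.toRateCertificate.tendsto_form

end CatalanRow

end Summit.KontsevichZagierPeriods.Zeta5Search.Certificates
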